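import Mathlib.Analysis.InnerProductSpace.PiL2
import Mathlib.Analysis.InnerProductSpace.Laplacian
import Mathlib.Analysis.InnerProductSpace.Calculus
import Mathlib.Analysis.Calculus.Gradient.Basic
import Literature.Analysis.FluidPDE.VectorCalculus
import HarnessLib

/-!
# Šverák's classification of scale-invariant steady Navier–Stokes flows: the Landau solutions

Topic `Literature/Analysis/FluidPDE`; named fact (result in print, `def … : Prop`, D-0014)
requested by the route `Summit.AnomalousDissipation.AnomalousDissipation.Theses.LandauJetArena`
(rationale fact (S): "no steady self-similar non-Landau state"; work item `wi-08933`), together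
with the explicit family it classifies.

* `landauAxisField a c`, `landauAxisPressure a c` — the **Landau solution** (Landau 1944, Squire
  1951) of the steady Navier–Stokes equations `−Δu + (u·∇)u + ∇p = 0`, `div u = 0` on `ℝ³ ∖ {0}`
  (viscosity `ν = 1`) with symmetry axis the unit vector `a` and parameter `c` (`|c| > 1`), in
  closed Cartesian form: with `r = |x|`, `s = ⟪a, x⟫`,
  `U(x) = (2/r²)((c² − 1) r²/(c r − s)² − 1) x + (2/(c r − s)) (a − (s/r²) x)`,
  `P(x) = 4 (c s − r)/(r (c r − s)²)`.
  For `a = e₁` these are **verbatim** the formulas `v_c`, `p_c` of Karch–Pilarczyk 2011, §1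
  (`landauAxisField_single_zero`, `landauAxisPressure_single_zero`); on the unit sphere, with the
  axis as polar axis and `c = coth κ`, they are Šverák's (4.7):
  `u = f e_r + v`, `v = −2 sin θ/(coth κ − cos θ) e_θ`, `f = 2/(cosh κ − sinh κ cos θ)² − 2`
  (use `1/sinh² κ = coth² κ − 1` and `e_θ = (cos θ e_r − a)/sin θ`).  The family is
  `(−1)`-homogeneous (`landauAxisField_smul`) and `(a, c) ↦ (−a, −c)` gives the same field
  (`landauAxisField_neg_neg`), so every Landau solution has a representative with `c > 1`.
* `Sverak2011_landauClassification` — **Šverák 2011, Theorem 1**: a smooth solution `u` of the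
  steady Navier–Stokes equations in `ℝ³ ∖ {0}` with `λ u(λx) = u(x)` for all `λ > 0` is either
  trivial or a Landau solution, i.e. `u = landauAxisField a c` on `ℝ³ ∖ {0}` for some unit vector
  `a` and some `c > 1` ("`u` is axi-symmetric and, in a suitable coordinate frame, is described by
  formulae (4.7)").

## Rendering

Physical space `ℝ³ = EuclideanSpace ℝ (Fin 3)`.  "Smooth solution of (1.1) in `ℝ³ ∖ {0}`" is
rendered classically and pointwise on `{x | x ≠ 0}`: `u` and a pressure `p` are `C^∞` on
`{x | x ≠ 0}` and `−Δu + (u·∇)u + ∇p = 0`, `div u = 0` hold at every `x ≠ 0`, with Mathlib's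
Laplacian `Δ` (`InnerProductSpace.Laplacian`), the tree's `convect u u = (u·∇)u` and
`VectorCalculus.divergence` (`VectorCalculus.lean`) and Mathlib's `gradient` — the same shape as
the tree's profile equation `IsLerayProfile` (`SelfSimilar.lean`) at `ν = 1`, `a = 0`, localised
away from the origin.  Šverák's proof (§4) only uses the very weak form of the equations in
`ℝ³ ∖ {0}` (a suitable `(−2)`-homogeneous pressure then exists), which the classical form implies,
so the hypotheses here are at least as strong as in print.  Scale invariance is imposed on
`ℝ³ ∖ {0}` only (the value `u 0` is junk and unconstrained).  The conclusion "Landau solution in a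
suitable frame" is the closed form above with an arbitrary unit axis `a` (the image of Šverák's
polar axis `e₃` under the frame rotation) and `c = coth κ > 1` (`κ < 0` is absorbed by `a ↦ −a`,
`landauAxisField_neg_neg`).  The values at `x = 0` of `landauAxisField`/`landauAxisPressure` are
junk (`0`, from `x/0 = 0`).

Not restated here: the distributional identity `−Δv_c + div(v_c ⊗ v_c) + ∇p_c = b(c) δ₀ e₁` with
`b(c) = 8πc/(3(c² − 1)) (2 + 6c² − 3c(c² − 1) log((c + 1)/(c − 1)))` (Šverák 2011, §4 Remark 1;
Karch–Pilarczyk 2011, §1, after Cannone–Karch 2004), Šverák's Corollary in §2 (a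
`(−1)`-homogeneous very weak solution across the origin, smooth away from it, vanishes for
`n ≥ 3`) and Theorems 2–3 (`n = 2`, `n ≥ 4`).

## Mathlib / tree search

Mathlib has no Navier–Stokes theory and no Landau solutions (`lean search landau|Landau`: only
Landau symbols / unrelated); the tree has steady Liouville facts on `ℝ³` (`SteadyNSLiouville.lean`,
`SteadyLiouvilleCriteria.lean`), self-similar profiles (`SelfSimilar.lean`) and the route file's
inline copy of Karch–Pilarczyk's `v_c` (`LandauJetArena.LandauOverDissipation`), but no
classification of homogeneous steady states.  Reused: `EuclideanSpace`, `inner`, `gradient`,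
`Laplacian`, `ContDiffOn`, tree `convect`, `VectorCalculus.divergence`.

## References

* V. Šverák, *On Landau's solutions of the Navier–Stokes equations*, J. Math. Sci. 179 (2011)
  208–228 (arXiv:math/0604550), §1 Theorem 1; §4 (proof, formulae (4.6)–(4.7), Remarks 1–2).
* G. Karch, D. Pilarczyk, *Asymptotic stability of Landau solutions to Navier–Stokes system*,
  Arch. Ration. Mech. Anal. 202 (2011) 115–131 (arXiv:1104.3589), §1: explicit `v_c`, `p_c`,
  `|c| > 1`, "satisfy (1.1) with `F ≡ 0` in the pointwise sense for every `x ∈ ℝ³ ∖ {0}`", and the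
  restatement of Šverák's theorem "then `(u, p) = (v_c, p_c)` … (modulo a rotation of `ℝ³`)".
* L. D. Landau, *A new exact solution of the Navier–Stokes equations*, Dokl. Akad. Nauk SSSR 43
  (1944) 286–288; H. B. Squire, *The round laminar jet*, Quart. J. Mech. Appl. Math. 4 (1951)
  321–329; L. D. Landau, E. M. Lifshitz, *Fluid Mechanics*, §23; G. K. Batchelor, *An Introduction
  to Fluid Dynamics* (1967), §4.6 (cited through Šverák 2011 and Karch–Pilarczyk 2011).
-/

noncomputable section

open WithLp
open scoped Laplacian InnerProductSpace RealInnerProductSpace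

namespace Literature.Analysis.FluidPDE

/-- Local notation for physical space `ℝ³ = EuclideanSpace ℝ (Fin 3)`. -/
local notation "ℝ³" => EuclideanSpace ℝ (Fin 3)

/-! ### The Landau solutions with an arbitrary axis -/

/-- The **Landau solution** (velocity) with symmetry axis `a` (a unit vector) and parameter `c`
(`|c| > 1`), viscosity `ν = 1`: with `r = |x|` and `s = ⟪a, x⟫ = r cos θ`,
`U(x) = (2/r²)((c² − 1) r²/(c r − s)² − 1) x + (2/(c r − s)) (a − (s/r²) x)`,
i.e. `u_r = (2/r)((c² − 1)/(c − cos θ)² − 1)`, `u_θ = −2 sin θ/(r (c − cos θ))`, `u_φ = 0` in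
spherical coordinates about `a` (Šverák 2011, (4.7) with `c = coth κ`, extended
`(−1)`-homogeneously; Karch–Pilarczyk 2011, §1, `v_c` for `a = e₁`, see
`landauAxisField_single_zero`).  Junk value at `x = 0`. [cite: Sverak2011, §4 (4.7)] -/
def landauAxisField (a : ℝ³) (c : ℝ) (x : ℝ³) : ℝ³ :=
  (2 * ((c ^ 2 - 1) * ‖x‖ ^ 2 / (c * ‖x‖ - ⟪a, x⟫) ^ 2 - 1) / ‖x‖ ^ 2) • x +
    (2 / (c * ‖x‖ - ⟪a, x⟫)) • (a - (⟪a, x⟫ / ‖x‖ ^ 2) • x)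

/-- The **Landau pressure** with axis `a` and parameter `c` (`ν = 1`): with `r = |x|`,
`s = ⟪a, x⟫`, `P(x) = 4 (c s − r)/(r (c r − s)²)`, i.e. `p = −4 (1 − c cos θ)/(r² (c − cos θ)²)`
(Karch–Pilarczyk 2011, §1, `p_c` for `a = e₁`, see `landauAxisPressure_single_zero`;
Landau–Lifshitz §23).  Junk value at `x = 0`. [cite: KarchPilarczyk2011, §1 (formula for p_c)] -/
def landauAxisPressure (a : ℝ³) (c : ℝ) (x : ℝ³) : ℝ :=
  4 * (c * ⟪a, x⟫ - ‖x‖) / (‖x‖ * (c * ‖x‖ - ⟪a, x⟫) ^ 2)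

/-- For `|c| > 1`, a unit axis `a` and `x ≠ 0` the denominator `c |x| − ⟪a, x⟫` does not vanish
(indeed `|⟪a, x⟫| ≤ |x| < |c| |x|`). [folklore] -/
theorem landauAxis_denom_ne_zero {a : ℝ³} (ha : ‖a‖ = 1) {c : ℝ} (hc : 1 < |c|) {x : ℝ³}
    (hx : x ≠ 0) : c * ‖x‖ - ⟪a, x⟫ ≠ 0 := by
  have hr : 0 < ‖x‖ := norm_pos_iff.mpr hx
  have hs : |⟪a, x⟫| ≤ ‖x‖ := by simpa [ha] using abs_real_inner_le_norm a x
  intro h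
  have h1 : |c| * ‖x‖ = |⟪a, x⟫| := by
    rw [← abs_of_pos hr, ← abs_mul, sub_eq_zero.mp h]
  nlinarith

/-- The Landau solutions are scale invariant, `U(λ x) = λ⁻¹ U(x)` for `λ > 0`
(`(−1)`-homogeneity; Šverák 2011, §1). [cite: Sverak2011, §1 Theorem 1] -/
theorem landauAxisField_smul (a : ℝ³) (c : ℝ) {t : ℝ} (ht : 0 < t) (x : ℝ³) :
    landauAxisField a c (t • x) = t⁻¹ • landauAxisField a c x := by
  have ht0 : t ≠ 0 := ht.ne'
  simp only [landauAxisField, norm_smul, Real.norm_of_nonneg ht.le, inner_smul_right]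
  have hd : c * (t * ‖x‖) - t * ⟪a, x⟫ = t * (c * ‖x‖ - ⟪a, x⟫) := by ring
  rw [hd]
  set r : ℝ := ‖x‖ with hr_def
  set s : ℝ := ⟪a, x⟫
  set d : ℝ := c * r - s
  have hK : (c ^ 2 - 1) * (t * r) ^ 2 / (t * d) ^ 2 = (c ^ 2 - 1) * r ^ 2 / d ^ 2 := by
    rw [mul_pow, mul_pow, mul_left_comm, mul_div_mul_left _ _ (pow_ne_zero 2 ht0)]
  rw [hK]
  ext i
  simp only [PiLp.add_apply, PiLp.smul_apply, PiLp.sub_apply, smul_eq_mul]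
  rcases eq_or_ne r 0 with hr | hr
  · have hx : x = 0 := norm_eq_zero.mp (hr_def ▸ hr)
    have hxi : x i = 0 := by rw [hx]; rfl
    rcases eq_or_ne d 0 with hd0 | hd0
    · simp [hr, hd0, hxi]
    · simp only [hr, hxi, mul_zero, sub_zero]
      field_simp
      ring
  · rcases eq_or_ne d 0 with hd0 | hd0
    · simp only [hd0, mul_zero, div_zero, zero_mul, add_zero, ne_eq, OfNat.ofNat_ne_zero,
        not_false_eq_true, zero_pow, zero_sub, mul_zero]
      field_simp
    · field_simp

/-- Reversing the axis and the sign of the parameter gives the same Landau solution,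
`U_{−a, −c} = U_{a, c}`; hence one may always take `c > 1`. [folklore] -/
theorem landauAxisField_neg_neg (a : ℝ³) (c : ℝ) (x : ℝ³) :
    landauAxisField (-a) (-c) x = landauAxisField a c x := by
  simp only [landauAxisField, inner_neg_left]
  have hd : -c * ‖x‖ - -⟪a, x⟫ = -(c * ‖x‖ - ⟪a, x⟫) := by ring
  rw [hd]
  ext i
  simp only [PiLp.add_apply, PiLp.smul_apply, PiLp.sub_apply, PiLp.neg_apply, smul_eq_mul,
    neg_sq, div_neg]
  ring

/-- The Landau pressure is `(−2)`-homogeneous, `P(λ x) = λ⁻² P(x)` for `λ > 0`. [folklore] -/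
theorem landauAxisPressure_smul (a : ℝ³) (c : ℝ) {t : ℝ} (ht : 0 < t) (x : ℝ³) :
    landauAxisPressure a c (t • x) = (t ^ 2)⁻¹ * landauAxisPressure a c x := by
  have ht0 : t ≠ 0 := ht.ne'
  simp only [landauAxisPressure, norm_smul, Real.norm_of_nonneg ht.le, inner_smul_right]
  set r : ℝ := ‖x‖
  set s : ℝ := ⟪a, x⟫
  have hd : c * (t * r) - t * s = t * (c * r - s) := by ring
  rw [hd]
  set d : ℝ := c * r - s
  rcases eq_or_ne r 0 with hr | hr
  · simp [hr]
  rcases eq_or_ne d 0 with hd0 | hd0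
  · simp [hd0]
  field_simp

/-- **Karch–Pilarczyk's Cartesian form.** For the axis `a = e₁ = EuclideanSpace.single 0 1`,
`|c| > 1` and `x ≠ 0`, `landauAxisField e₁ c x` is verbatim Karch–Pilarczyk's
`v_c(x) = ( 2(c|x|² − 2x₁|x| + c x₁²), 2x₂(c x₁ − |x|), 2x₃(c x₁ − |x|) ) / (|x| (c|x| − x₁)²)`
(Karch–Pilarczyk 2011, §1; the expression inlined in the route item
`LandauJetArena.LandauOverDissipation`). (At the excluded points the two sides differ only by junk
conventions.) [cite: KarchPilarczyk2011, §1 (formula for v_c)] -/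
theorem landauAxisField_single_zero {c : ℝ} (hc : 1 < |c|) {x : ℝ³} (hx : x ≠ 0) :
    landauAxisField (EuclideanSpace.single 0 1) c x =
      !₂[2 * (c * ‖x‖ ^ 2 - 2 * x 0 * ‖x‖ + c * x 0 ^ 2) / (‖x‖ * (c * ‖x‖ - x 0) ^ 2),
        2 * (x 1 * (c * x 0 - ‖x‖)) / (‖x‖ * (c * ‖x‖ - x 0) ^ 2),
        2 * (x 2 * (c * x 0 - ‖x‖)) / (‖x‖ * (c * ‖x‖ - x 0) ^ 2)] := by
  have ha : ‖(EuclideanSpace.single 0 1 : ℝ³)‖ = 1 := by simp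
  have hd := landauAxis_denom_ne_zero ha hc hx
  have hs : ⟪(EuclideanSpace.single 0 1 : ℝ³), x⟫ = x 0 := by
    rw [EuclideanSpace.inner_single_left]; simp
  rw [hs] at hd
  have hr : ‖x‖ ≠ 0 := norm_ne_zero_iff.mpr hx
  simp only [landauAxisField, hs]
  ext i
  fin_cases i
  · simp only [Fin.zero_eta, Fin.isValue, PiLp.add_apply, PiLp.smul_apply, PiLp.sub_apply,
      PiLp.single_apply, smul_eq_mul]
    simp
    field_simp
    ring
  · simp only [Fin.mk_one, Fin.isValue, PiLp.add_apply, PiLp.smul_apply, PiLp.sub_apply,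
      PiLp.single_apply, smul_eq_mul]
    simp
    field_simp
    ring
  · simp only [Fin.reduceFinMk, Fin.isValue, PiLp.add_apply, PiLp.smul_apply, PiLp.sub_apply,
      PiLp.single_apply, smul_eq_mul]
    simp
    field_simp
    ring

/-- For the axis `a = e₁`, `landauAxisPressure e₁ c` is verbatim Karch–Pilarczyk's
`p_c(x) = 4 (c x₁ − |x|)/(|x| (c|x| − x₁)²)` (Karch–Pilarczyk 2011, §1).
[cite: KarchPilarczyk2011, §1 (formula for p_c)] -/
theorem landauAxisPressure_single_zero (c : ℝ) (x : ℝ³) :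
    landauAxisPressure (EuclideanSpace.single 0 1) c x =
      4 * (c * x 0 - ‖x‖) / (‖x‖ * (c * ‖x‖ - x 0) ^ 2) := by
  have hs : ⟪(EuclideanSpace.single 0 1 : ℝ³), x⟫ = x 0 := by
    rw [EuclideanSpace.inner_single_left]; simp
  simp only [landauAxisPressure, hs]

/-- The Landau solutions are smooth away from the origin (for a unit axis and `|c| > 1` the
denominators `|x|` and `c|x| − ⟪a, x⟫` do not vanish on `ℝ³ ∖ {0}`). [folklore] -/
theorem contDiffOn_landauAxisField {a : ℝ³} (ha : ‖a‖ = 1) {c : ℝ} (hc : 1 < |c|) {n : ℕ∞} :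
    ContDiffOn ℝ n (landauAxisField a c) {x | x ≠ 0} := by
  have hnorm : ContDiffOn ℝ n (fun x : ℝ³ => ‖x‖) {x | x ≠ 0} := fun x hx =>
    (contDiffAt_norm ℝ hx).contDiffWithinAt
  have hinner : ContDiffOn ℝ n (fun x : ℝ³ => ⟪a, x⟫) {x | x ≠ 0} :=
    (contDiff_const.inner ℝ contDiff_id).contDiffOn
  have hden : ContDiffOn ℝ n (fun x : ℝ³ => c * ‖x‖ - ⟪a, x⟫) {x | x ≠ 0} :=
    (contDiffOn_const.mul hnorm).sub hinner
  have hden0 : ∀ x ∈ {x : ℝ³ | x ≠ 0}, c * ‖x‖ - ⟪a, x⟫ ≠ 0 := fun x hx =>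
    landauAxis_denom_ne_zero ha hc hx
  have hr0 : ∀ x ∈ {x : ℝ³ | x ≠ 0}, ‖x‖ ^ 2 ≠ 0 := fun x hx =>
    pow_ne_zero 2 (norm_ne_zero_iff.mpr hx)
  have hk₁ : ContDiffOn ℝ n
      (fun x : ℝ³ => 2 * ((c ^ 2 - 1) * ‖x‖ ^ 2 / (c * ‖x‖ - ⟪a, x⟫) ^ 2 - 1) / ‖x‖ ^ 2)
      {x | x ≠ 0} :=
    (contDiffOn_const.mul ((((contDiffOn_const.mul (hnorm.pow 2)).div (hden.pow 2)
      (fun x hx => pow_ne_zero 2 (hden0 x hx))).sub contDiffOn_const))).div (hnorm.pow 2) hr0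
  have hk₂ : ContDiffOn ℝ n (fun x : ℝ³ => 2 / (c * ‖x‖ - ⟪a, x⟫)) {x | x ≠ 0} :=
    contDiffOn_const.div hden hden0
  have hk₃ : ContDiffOn ℝ n (fun x : ℝ³ => ⟪a, x⟫ / ‖x‖ ^ 2) {x | x ≠ 0} :=
    hinner.div (hnorm.pow 2) hr0
  exact (hk₁.smul contDiffOn_id).add (hk₂.smul (contDiffOn_const.sub (hk₃.smul contDiffOn_id)))

/-! ### Šverák's theorem -/

/-- **Šverák 2011, Theorem 1 (classification of scale-invariant steady Navier–Stokes flows in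
`ℝ³ ∖ {0}`).** "Assume that `u : ℝ³ ∖ {0} → ℝ³` is a non-trivial smooth solution of
`−Δu + u∇u + ∇p = 0`, `div u = 0` satisfying `λ u(λx) = u(x)` for each `λ > 0`. Then `u` is a
Landau solution. In other words, `u` is axi-symmetric and, in a suitable coordinate frame, is
described by formulae (4.7)."  Rendering (see the module docstring): `u` and a pressure `p` are
`C^∞` on `{x | x ≠ 0}`, the equations hold pointwise at every `x ≠ 0` (viscosity `ν = 1`, no
force; `Δ` = Mathlib's Laplacian, `convect u u = (u·∇)u`, `VectorCalculus.divergence`,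
`gradient`), scale invariance holds on `ℝ³ ∖ {0}`; conclusion: `u` vanishes on `ℝ³ ∖ {0}`, or
`u = landauAxisField a c` on `ℝ³ ∖ {0}` for some unit vector `a` (the symmetry axis) and some
`c > 1` (Šverák's `coth κ`; `c > 1` is no loss by `landauAxisField_neg_neg`).  Restated in
Karch–Pilarczyk 2011, §1 ("then `(u, p) = (v_c, p_c)` … modulo a rotation of `ℝ³`").
[cite: Sverak2011, §1 Theorem 1] -/
def Sverak2011_landauClassification : Prop :=
  ∀ (u : ℝ³ → ℝ³) (p : ℝ³ → ℝ),
    ContDiffOn ℝ (⊤ : ℕ∞) u {x | x ≠ 0} → ContDiffOn ℝ (⊤ : ℕ∞) p {x | x ≠ 0} →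
    (∀ x, x ≠ 0 → -(Δ u) x + convect u u x + gradient p x = 0) →
    (∀ x, x ≠ 0 → VectorCalculus.divergence u x = 0) →
    (∀ (t : ℝ) (x : ℝ³), 0 < t → x ≠ 0 → t • u (t • x) = u x) →
    (∀ x, x ≠ 0 → u x = 0) ∨
      ∃ a : ℝ³, ‖a‖ = 1 ∧ ∃ c : ℝ, 1 < c ∧ ∀ x, x ≠ 0 → u x = landauAxisField a c x

/-! ### API -/

/-- Šverák's theorem in the "non-trivial ⇒ Landau" form of the printed statement: if `u` does not
vanish identically on `ℝ³ ∖ {0}`, it is a Landau solution `landauAxisField a c` with `‖a‖ = 1`,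
`c > 1`. [cite: Sverak2011, §1 Theorem 1] -/
theorem Sverak2011_landauClassification.of_nontrivial (h : Sverak2011_landauClassification)
    {u : ℝ³ → ℝ³} {p : ℝ³ → ℝ} (hu : ContDiffOn ℝ (⊤ : ℕ∞) u {x | x ≠ 0})
    (hp : ContDiffOn ℝ (⊤ : ℕ∞) p {x | x ≠ 0})
    (hns : ∀ x, x ≠ 0 → -(Δ u) x + convect u u x + gradient p x = 0)
    (hdiv : ∀ x, x ≠ 0 → VectorCalculus.divergence u x = 0)
    (hhom : ∀ (t : ℝ) (x : ℝ³), 0 < t → x ≠ 0 → t • u (t • x) = u x)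
    {x₀ : ℝ³} (hx₀ : x₀ ≠ 0) (hux₀ : u x₀ ≠ 0) :
    ∃ a : ℝ³, ‖a‖ = 1 ∧ ∃ c : ℝ, 1 < c ∧ ∀ x, x ≠ 0 → u x = landauAxisField a c x := by
  rcases h u p hu hp hns hdiv hhom with h0 | hL
  · exact absurd (h0 x₀ hx₀) hux₀
  · exact hL

/-- In the Landau alternative of Šverák's theorem the parameter may equally be taken with the
opposite orientation of the axis: `u = landauAxisField (−a) (−c)` with `−c < −1`, matching
Karch–Pilarczyk's convention `|c| > 1` for a fixed axis. [folklore] -/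
theorem Sverak2011_landauClassification.landau_abs (h : Sverak2011_landauClassification)
    {u : ℝ³ → ℝ³} {p : ℝ³ → ℝ} (hu : ContDiffOn ℝ (⊤ : ℕ∞) u {x | x ≠ 0})
    (hp : ContDiffOn ℝ (⊤ : ℕ∞) p {x | x ≠ 0})
    (hns : ∀ x, x ≠ 0 → -(Δ u) x + convect u u x + gradient p x = 0)
    (hdiv : ∀ x, x ≠ 0 → VectorCalculus.divergence u x = 0)
    (hhom : ∀ (t : ℝ) (x : ℝ³), 0 < t → x ≠ 0 → t • u (t • x) = u x) :
    (∀ x, x ≠ 0 → u x = 0) ∨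
      ∃ a : ℝ³, ‖a‖ = 1 ∧ ∃ c : ℝ, 1 < |c| ∧ ∀ x, x ≠ 0 → u x = landauAxisField a c x := by
  rcases h u p hu hp hns hdiv hhom with h0 | ⟨a, ha, c, hc, hL⟩
  · exact Or.inl h0
  · exact Or.inr ⟨a, ha, c, lt_of_lt_of_le hc (le_abs_self c), hL⟩

end Literature.Analysis.FluidPDE
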